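import Literature.IUT.HodgeTheaters.SplitFrobenioids
import Literature.IUT.HodgeTheaters.BadLocalFrobenioid
import Mathlib.CategoryTheory.EssentialImage
import Mathlib.CategoryTheory.MorphismProperty.Basic
import HarnessLib

/-!
# `ReconstructibleAlong` for NON-FULL faithful subcategory inclusions ([IUTchI] Rmk. 3.2.1 (i); the shape of
# Ex. 3.3 (iii) (d) `C⊢_v ⊆ C_v` and Ex. 3.2 (iii) `C_v ⊆ F̲_v`)

Mochizuki, *Inter-universal Teichmüller theory I*, kurims manuscript (May 2020), Remark 3.2.1 (i) p. 73
("reconstructed category-theoretically" = "preserved by arbitrary equivalences of categories"), Example 3.2 (iii)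
p. 70 ("`C_v ⊆ F̲_v`"), Example 3.3 (i)/(iii) (d) pp. 77–79 ("`C⊢_v ⊆ C_v`, a subcategory … `Φ_{C⊢_v} ⊆ Φ_{C_v}|_{D⊢_v}`
an absolutely primitive submonoid"; "(d) the category `C⊢_v` may be reconstructed category-theoretically from `F̲_v`")
[claim: Mochizuki2012, status: disputed] (nothing of the series is asserted; no side is taken on [IUTchIII] Cor. 3.12).

PROOF-ONLY category theory (abc-iut cell, seat abc-iut-w4-d047 gen 3), generalising this seat's criterion for FULL
subcategory inclusions (`reconstructibleAlong_of_essImage_invariant`, `ReconstructibleAlongCriterion.lean`) to the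
subcategories abc-iut-L5-t2's interfaces actually use at clauses (d)/(iii): a FAITHFUL functor `Φ : T ⥤ S` whose image on
every hom-set `Φ(t₁) → Φ(t₂)` is cut out by a morphism property `P` of `S` stable under composition with isomorphisms
("morphisms whose zero divisor lies in `ℕ·log(p_v)`", "linear morphisms", …).  THEN `ReconstructibleAlong Φ` — every
self-equivalence `e` of `S` lifts, compatibly, to a self-equivalence of `T` — as soon as every self-equivalence of `S`
(1) maps each object `Φ(t)` to an object isomorphic to some `Φ(t')` and (2) preserves `P`
(`reconstructibleAlong_of_faithful`).  Mechanism: choose the objects and transport the morphisms through the `P`-lifting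
(`exists_functor_lift`); the lifted functor is faithful, FULL (because `e⁻¹` also preserves `P`, so `e` reflects it) and
essentially surjective (isomorphisms between image objects lift, `exists_iso_lift`), hence an equivalence.
Sockets: `GoodLocalFrobenioid.cdashFromF_of_morphismProperty` (Ex. 3.3 (iii) (d)) and
`BadLocalFrobenioid.cFromF_of_morphismProperty` (Ex. 3.2 (iii), the hull `C_v ⊆ F̲_v`).
-/

namespace Literature.IUT.HodgeTheaters

open CategoryTheory

universe u

section NonFull

variable {S T : Type u} [Category.{u} S] [Category.{u} T] (Φ : T ⥤ S) [Φ.Faithful] (P : MorphismProperty S)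
  [P.RespectsIso]

/-- **Isomorphisms between image objects lift** along a faithful `Φ` whose hom-images are cut out by an iso-stable
`P` containing the images of identities. [claim: Mochizuki2012, status: disputed] -/
theorem exists_iso_lift (hPΦ : ∀ {t₁ t₂ : T} (f : t₁ ⟶ t₂), P (Φ.map f))
    (hlift : ∀ {t₁ t₂ : T} (g : Φ.obj t₁ ⟶ Φ.obj t₂), P g → ∃ f : t₁ ⟶ t₂, Φ.map f = g)
    {t₁ t₂ : T} (s : Φ.obj t₁ ≅ Φ.obj t₂) : ∃ i : t₁ ≅ t₂, Φ.map i.hom = s.hom := by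
  have h1 : P s.hom := by
    have h := P.cancel_right_of_respectsIso (𝟙 (Φ.obj t₁)) s.hom
    rw [Category.id_comp] at h
    exact h.2 (by simpa using hPΦ (𝟙 t₁))
  have h2 : P s.inv := by
    have h := P.cancel_right_of_respectsIso (𝟙 (Φ.obj t₂)) s.inv
    rw [Category.id_comp] at h
    exact h.2 (by simpa using hPΦ (𝟙 t₂))
  obtain ⟨f, hf⟩ := hlift s.hom h1
  obtain ⟨g, hg⟩ := hlift s.inv h2
  refine ⟨⟨f, g, Φ.map_injective ?_, Φ.map_injective ?_⟩, hf⟩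
  · rw [Φ.map_comp, hf, hg, s.hom_inv_id, Φ.map_id]
  · rw [Φ.map_comp, hf, hg, s.inv_hom_id, Φ.map_id]

/-- **Transport of a functor `E : S ⥤ S` along `Φ`**: if `E` maps every `Φ(t)` into the essential image of `Φ` and
preserves `P`, there is `F' : T ⥤ T` with `F' ⋙ Φ ≅ Φ ⋙ E`. [claim: Mochizuki2012, status: disputed] -/
theorem exists_functor_lift (hPΦ : ∀ {t₁ t₂ : T} (f : t₁ ⟶ t₂), P (Φ.map f))
    (hlift : ∀ {t₁ t₂ : T} (g : Φ.obj t₁ ⟶ Φ.obj t₂), P g → ∃ f : t₁ ⟶ t₂, Φ.map f = g)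
    (E : S ⥤ S) (hobjE : ∀ t : T, Φ.essImage (E.obj (Φ.obj t)))
    (hmorE : ∀ {X Y : S} (g : X ⟶ Y), P g → P (E.map g)) :
    ∃ F' : T ⥤ T, Nonempty (F' ⋙ Φ ≅ Φ ⋙ E) := by
  classical
  let o : T → T := fun t => (hobjE t).witness
  let i : ∀ t, Φ.obj (o t) ≅ E.obj (Φ.obj t) := fun t => (hobjE t).getIso
  have hP : ∀ {t₁ t₂ : T} (f : t₁ ⟶ t₂), P ((i t₁).hom ≫ E.map (Φ.map f) ≫ (i t₂).inv) := fun f =>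
    MorphismProperty.RespectsIso.precomp P _ _ (MorphismProperty.RespectsIso.postcomp P _ _ (hmorE _ (hPΦ f)))
  have hex : ∀ {t₁ t₂ : T} (f : t₁ ⟶ t₂), ∃ g : o t₁ ⟶ o t₂,
      Φ.map g = (i t₁).hom ≫ E.map (Φ.map f) ≫ (i t₂).inv := fun f => hlift _ (hP f)
  let m : ∀ {t₁ t₂ : T}, (t₁ ⟶ t₂) → (o t₁ ⟶ o t₂) := fun f => (hex f).choose
  have hm : ∀ {t₁ t₂ : T} (f : t₁ ⟶ t₂), Φ.map (m f) = (i t₁).hom ≫ E.map (Φ.map f) ≫ (i t₂).inv := fun f =>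
    (hex f).choose_spec
  let F' : T ⥤ T :=
    { obj := o
      map := fun f => m f
      map_id := fun t => Φ.map_injective (by
        rw [hm, Φ.map_id, Φ.map_id, E.map_id, Category.id_comp, Iso.hom_inv_id])
      map_comp := fun f g => Φ.map_injective (by
        rw [hm, Φ.map_comp (m f) (m g), hm, hm, Φ.map_comp, E.map_comp]
        simp only [Category.assoc, Iso.inv_hom_id_assoc]) }
  refine ⟨F', ⟨NatIso.ofComponents (fun t => i t) ?_⟩⟩
  intro t₁ t₂ f
  change Φ.map (m f) ≫ (i t₂).hom = (i t₁).hom ≫ E.map (Φ.map f)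
  rw [hm, Category.assoc, Category.assoc, Iso.inv_hom_id, Category.comp_id]

/-- **`ReconstructibleAlong` for a faithful, possibly non-full `Φ : T ⥤ S`** whose hom-images are cut out by an
iso-stable morphism property `P` of `S` (`hPΦ`, `hlift`): if every self-equivalence of `S` maps the objects `Φ(t)` into
the essential image of `Φ` (`hobj`) and preserves `P` (`hmor`), then every self-equivalence `e` of `S` lifts to a
self-equivalence `e'` of `T` with `Φ ⋙ e ≅ e' ⋙ Φ` (the Rmk. 3.2.1 (i) reading).  The full case (`P = ⊤`) is this seat's
`reconstructibleAlong_of_essImage_invariant`. [claim: Mochizuki2012, status: disputed] -/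
theorem reconstructibleAlong_of_faithful (hPΦ : ∀ {t₁ t₂ : T} (f : t₁ ⟶ t₂), P (Φ.map f))
    (hlift : ∀ {t₁ t₂ : T} (g : Φ.obj t₁ ⟶ Φ.obj t₂), P g → ∃ f : t₁ ⟶ t₂, Φ.map f = g)
    (hobj : ∀ (e : S ≌ S) (t : T), Φ.essImage (e.functor.obj (Φ.obj t)))
    (hmor : ∀ (e : S ≌ S) {X Y : S} (g : X ⟶ Y), P g → P (e.functor.map g)) :
    ReconstructibleAlong Φ := by
  intro e
  obtain ⟨F', ⟨α⟩⟩ := exists_functor_lift Φ P hPΦ hlift e.functor (hobj e) (fun g hg => hmor e g hg)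
  let β : ∀ t : T, Φ.obj (F'.obj t) ≅ e.functor.obj (Φ.obj t) := fun t => α.app t
  -- `Φ(F' f) = β ≫ e(Φ f) ≫ β⁻¹`
  have hβ : ∀ {t₁ t₂ : T} (f : t₁ ⟶ t₂),
      Φ.map (F'.map f) = (β t₁).hom ≫ e.functor.map (Φ.map f) ≫ (β t₂).inv := by
    intro t₁ t₂ f
    have h := α.hom.naturality f
    change Φ.map (F'.map f) ≫ (β t₂).hom = (β t₁).hom ≫ e.functor.map (Φ.map f) at h
    rw [← reassoc_of% h, Iso.hom_inv_id, Category.comp_id]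
  -- `e` reflects `P` (apply `hmor` to `e⁻¹`)
  have hrefl : ∀ {X Y : S} (g : X ⟶ Y), P (e.functor.map g) → P g := by
    intro X Y g hg
    have h := hmor e.symm (e.functor.map g) hg
    change P (e.inverse.map (e.functor.map g)) at h
    rw [Equivalence.inv_fun_map] at h
    let u : X ≅ e.inverse.obj (e.functor.obj X) := e.unitIso.app X
    let v : Y ≅ e.inverse.obj (e.functor.obj Y) := e.unitIso.app Y
    have h' : P (u.inv ≫ g ≫ v.hom) := h
    have h2 := (P.cancel_left_of_respectsIso u.inv (g ≫ v.hom)).1 h'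
    exact (P.cancel_right_of_respectsIso g v.hom).1 h2
  haveI : F'.Faithful := by
    haveI : (F' ⋙ Φ).Faithful := Functor.Faithful.of_iso α.symm
    exact Functor.Faithful.of_comp F' Φ
  haveI : F'.Full := ⟨fun {t₁ t₂} h => by
    let g : Φ.obj t₁ ⟶ Φ.obj t₂ := e.functor.preimage ((β t₁).inv ≫ Φ.map h ≫ (β t₂).hom)
    have hg : e.functor.map g = (β t₁).inv ≫ Φ.map h ≫ (β t₂).hom := e.functor.map_preimage _
    have hPg : P g := hrefl g (by
      rw [hg]
      exact MorphismProperty.RespectsIso.precomp P _ _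
        (MorphismProperty.RespectsIso.postcomp P _ _ (hPΦ h)))
    obtain ⟨f, hf⟩ := hlift g hPg
    refine ⟨f, Φ.map_injective ?_⟩
    rw [hβ, hf, hg]
    simp only [Category.assoc, Iso.hom_inv_id_assoc, Iso.hom_inv_id, Category.comp_id]⟩
  haveI : F'.EssSurj := ⟨fun t => by
    obtain ⟨t₀, ⟨j⟩⟩ := hobj e.symm t
    -- `Φ(F' t₀) ≅ e(Φ t₀) ≅ e(e⁻¹(Φ t)) ≅ Φ t`
    let s : Φ.obj (F'.obj t₀) ≅ Φ.obj t :=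
      β t₀ ≪≫ e.functor.mapIso j ≪≫ e.counitIso.app (Φ.obj t)
    obtain ⟨i', -⟩ := exists_iso_lift Φ P hPΦ hlift s
    exact ⟨t₀, ⟨i'⟩⟩⟩
  haveI : F'.IsEquivalence := {}
  exact ⟨F'.asEquivalence, ⟨α.symm⟩⟩

end NonFull

/-! ### Sockets for the typed clauses -/

namespace GoodLocalFrobenioid

variable {p : ℕ} {Kv : Type} [Field Kv] [ValuativeRel Kv]

/-- **Socket for [IUTchI] Ex. 3.3 (iii) (d)** (`v ∈ V̲^good ∩ V̲^non`): `CdashFromF` (reconstructibility of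
`C⊢_v` along the FAITHFUL, non-full `C⊢_v ⊆ C_v`) follows as soon as the image of `C⊢_v` on hom-sets is cut out by an
iso-stable property `P` of `C_v`-morphisms which every self-equivalence of `C_v` preserves, and every self-equivalence
maps objects of `C⊢_v` to objects isomorphic to objects of `C⊢_v` (print: [FrdI] Cor. 4.11 (iii), [FrdII] Thm. 1.2 (i),
(a), (c)). [claim: Mochizuki2012, status: disputed] -/
theorem cdashFromF_of_morphismProperty (G : GoodLocalFrobenioid.{u} p Kv) (P : MorphismProperty G.Cv)
    [P.RespectsIso] (hPΦ : ∀ {t₁ t₂ : G.Cdash} (f : t₁ ⟶ t₂), P (G.CdashToC.map f))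
    (hlift : ∀ {t₁ t₂ : G.Cdash} (g : G.CdashToC.obj t₁ ⟶ G.CdashToC.obj t₂), P g →
      ∃ f : t₁ ⟶ t₂, G.CdashToC.map f = g)
    (hobj : ∀ (e : G.Cv ≌ G.Cv) (t : G.Cdash), G.CdashToC.essImage (e.functor.obj (G.CdashToC.obj t)))
    (hmor : ∀ (e : G.Cv ≌ G.Cv) {X Y : G.Cv} (g : X ⟶ Y), P g → P (e.functor.map g)) : G.CdashFromF :=
  reconstructibleAlong_of_faithful G.CdashToC P hPΦ hlift hobj hmor

end GoodLocalFrobenioid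

namespace BadLocalFrobenioid

variable {l : ℕ} {Kv : Type} [Field Kv] [ValuativeRel Kv]

/-- **Socket for [IUTchI] Ex. 3.2 (iii)** (`v ∈ V̲^bad`): `CFromF` (reconstructibility of the `p_v`-adic Frobenioid
`C_v` along the FAITHFUL base-field-theoretic hull `C_v ⊆ F̲_v`) follows from a hom-image description `P` preserved by
every self-equivalence of `F̲_v` plus essential-image invariance on objects (print: [EtTh] Cor. 3.8 (ii), Prop. 5.1).
[claim: Mochizuki2012, status: disputed] -/
theorem cFromF_of_morphismProperty (B : BadLocalFrobenioid.{u} l Kv) (P : MorphismProperty B.Fv)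
    [P.RespectsIso] (hPΦ : ∀ {t₁ t₂ : B.Cv} (f : t₁ ⟶ t₂), P (B.hull.map f))
    (hlift : ∀ {t₁ t₂ : B.Cv} (g : B.hull.obj t₁ ⟶ B.hull.obj t₂), P g → ∃ f : t₁ ⟶ t₂, B.hull.map f = g)
    (hobj : ∀ (e : B.Fv ≌ B.Fv) (t : B.Cv), B.hull.essImage (e.functor.obj (B.hull.obj t)))
    (hmor : ∀ (e : B.Fv ≌ B.Fv) {X Y : B.Fv} (g : X ⟶ Y), P g → P (e.functor.map g)) : B.CFromF :=
  reconstructibleAlong_of_faithful B.hull P hPΦ hlift hobj hmor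

end BadLocalFrobenioid

end Literature.IUT.HodgeTheaters
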